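import Literature.NumberTheory.EllipticCurves.TwistFamilySelmerCorankParityProofs
import Literature.NumberTheory.EllipticCurves.BSDInvariantsProofs
import Literature.NumberTheory.EllipticCurves.VariableChangePoints
import HarnessLib

/-!
# `#Sel^{(n)}(E/K)` and `rk E(K)` are invariants of the `K`-isomorphism class; the BKLOS `19a3`
# proportions in the usual ordering of quadratic twists over `ℚ` (squarefree `d`, `|d| < X`)

`Proofs` file (theorems only; no definition, no named fact — D-0014/D-0026), cross-ladder
literature-typing layer (cell `bsd-littype`, seat 08, gen 4). Honest framing of the cell: "typed ≠
proved ≠ endorsed"; bookkeeping in twist families only.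

Bhargava–Klagsbrun–Lemke Oliver–Shnidman, Duke Math. J. 168 (2019), §2 (chunk p0004 L30 of the held
text `paper:arxiv-1709.09790`), VERBATIM: "If `F = ℚ`, then `Σ(X)` consists of the squareclasses
of all squarefree integers of absolute value less than `X`, recovering the usual ordering of
quadratic twists over `ℚ`." The tree's dictionary `squareClassProportionGe_twist_rat_iff`
(`SquareClassHeightRat.lean`) turns a statement "at least `δ` of `t ∈ ℚ^×/(ℚ^×)²` (by height) have
`P(E^{(t)})`" into "`δ ≤ liminf_X #{d squarefree : |d| < X, P(E_d)}/#{d squarefree : |d| < X}`" for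
every ISOMORPHISM-INVARIANT `P` (hypothesis `hP`: `P(E^{(s)}) ↔ P(E^{(s u²)})`, the twists of one
square class being `K`-isomorphic, `exists_variableChange_quadraticTwist_mul_sq`). The two
predicates of the REFEREED `19a3` fact
`BhargavaKlagsbrunLemkeOliverShnidman2019.cremona19a3_rankZero_selmerRankOne_proportions`
(`GoldfeldProportionsCremona19a3.lean`) are `E.mordellWeilRank = 0` and `#Sel^{(3)}(E/ℚ) = 3`; this
file supplies their invariance under admissible changes of variables (Silverman *AEC* III.3.1(b),
X.4.2: `rk`, `#E(K)[n]`, `#(Ш ⊓ H¹[n])` and hence `#Sel^{(n)} = n^{rk}·#E(K)[n]·#(Ш ⊓ H¹[n])` are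
attached to `E/K`, not to an equation) and the resulting `ℚ`-ordering forms of the `19a3` clauses.

## Contents

* §1 `natCard_torsionBy_congr` (an additive isomorphism preserves `#A[n]`),
  `natCard_torsionBy_point_smul`, `natCard_sha_inf_torsionBy_smul`, `natCard_selmerGroup_smul` —
  **`#Sel^{(n)}((C • W)/K) = #Sel^{(n)}(W/K)`** for every admissible change of variables `C`
  (descent count `natCard_selmerGroup_eq` + `pointEquiv` + `galH1Equiv`/`mem_sha_iff_galH1Equiv_mem`
  + `mordellWeilRank_variableChange_holds`).
* §2 `mordellWeilRank_quadraticTwist_eq_of_mk_eq`, `natCard_selmerGroup_quadraticTwist_eq_of_mk_eq`,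
  `twistClassSatisfies_mordellWeilRank_squareClassOf_iff`,
  `twistClassSatisfies_natCard_selmerGroup_squareClassOf_iff` — representative-independence for
  the two BKLOS predicates (so "every representative" = "some representative").
* §3 `BhargavaKlagsbrunLemkeOliverShnidman2019.cremona19a3_proportion_rank_zero_rat`,
  `…_proportion_card_selmerGroup_three_rat`, `…_proportion_selmerCorank_three_eq_one_rat` — the
  `19a3` clauses, and the derived corank-`1` clause of `TwistFamilySelmerCorankParityProofs.lean`,
  in the usual ordering over `ℚ` ("`≥ 25%` / `≥ 5/12` of the squarefree `d`, `|d| < X`").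

## References

* [SilvermanAEC2009] III.3.1(b) (isomorphic equations, isomorphic point groups), X.4.2 (descent
  count), X.§4 (`Ш` attached to `E/K`).
* [BhargavaKlagsbrunLemkeOliverShnidman2019] §2 (`Σ(X)` for `F = ℚ`; the `19a3` paragraph, chunk
  p0005 L40–L41; Thm. 2.5).
-/

noncomputable section

open scoped Classical AddSubgroup
open Filter Topology
open WeierstrassCurve

universe u

namespace Literature.NumberTheory.EllipticCurves

/-! ## §1 Invariance of `#E(K)[n]`, `#(Ш ⊓ H¹[n])`, `#Sel^{(n)}` under admissible changes of variables -/

section VariableChange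

/-- Membership in the `n`-torsion subgroup: `x ∈ A[n] ↔ n • x = 0`. [folklore] -/
private theorem mem_torsionBy_iff_zsmul {A : Type*} [AddCommGroup A] (n : ℤ) (x : A) :
    x ∈ A[n] ↔ n • x = 0 :=
  Submodule.mem_torsionBy_iff n x

/-- An additive isomorphism `A ≃+ B` restricts to a bijection `A[n] ≃ B[n]` of `n`-torsion
subgroups, so `#A[n] = #B[n]`. [cite: SilvermanAEC2009, III.3.1(b) (isomorphic groups of points)] -/
theorem natCard_torsionBy_congr {A B : Type*} [AddCommGroup A] [AddCommGroup B] (e : A ≃+ B)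
    (n : ℤ) : Nat.card (A[n]) = Nat.card (B[n]) := by
  refine Nat.card_congr (e.toEquiv.subtypeEquiv fun x ↦ ?_)
  change x ∈ A[n] ↔ e x ∈ B[n]
  rw [mem_torsionBy_iff_zsmul, mem_torsionBy_iff_zsmul, ← map_zsmul e n x,
    AddEquiv.map_eq_zero_iff]

variable {K : Type u} [Field K] [NumberField K] (W : WeierstrassCurve K) (C : VariableChange K)

omit [NumberField K] in
/-- **`#(C • W)(K)[n] = #W(K)[n]`**: the change of variables `(x, y) ↦ (u⁻²(x − r), …)` is an
isomorphism of point groups (`VariableChange.pointEquiv`). [cite: SilvermanAEC2009, III.3.1(b)] -/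
theorem natCard_torsionBy_point_smul (n : ℤ) :
    Nat.card ((C • W).toAffine.Point[n]) = Nat.card (W.toAffine.Point[n]) :=
  (natCard_torsionBy_congr (VariableChange.pointEquiv W C) n).symm

/-- **`#(Ш(C • W) ⊓ H¹(K, C • W)[n]) = #(Ш(W) ⊓ H¹(K, W)[n])`**: the isomorphism
`galH1Equiv : H¹(K, W) ≃+ H¹(K, C • W)` preserves `Ш` (`mem_sha_iff_galH1Equiv_mem`) and `n`-torsion.
[cite: SilvermanAEC2009, X.§4 (Ш is attached to E/K)] -/
theorem natCard_sha_inf_torsionBy_smul (n : ℤ) :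
    Nat.card ((C • W).sha ⊓ AddSubgroup.torsionBy (C • W).galH1 n : AddSubgroup (C • W).galH1) =
      Nat.card (W.sha ⊓ AddSubgroup.torsionBy W.galH1 n : AddSubgroup W.galH1) := by
  symm
  refine Nat.card_congr ((galH1Equiv W C).toEquiv.subtypeEquiv fun c ↦ ?_)
  change c ∈ (W.sha ⊓ AddSubgroup.torsionBy W.galH1 n : AddSubgroup W.galH1) ↔
    galH1Equiv W C c ∈ ((C • W).sha ⊓ AddSubgroup.torsionBy (C • W).galH1 n : AddSubgroup _)
  rw [AddSubgroup.mem_inf, AddSubgroup.mem_inf, mem_sha_iff_galH1Equiv_mem W C]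
  refine and_congr Iff.rfl ?_
  rw [mem_torsionBy_iff_zsmul, mem_torsionBy_iff_zsmul, ← map_zsmul (galH1Equiv W C) n c,
    AddEquiv.map_eq_zero_iff]

variable [W.IsElliptic]

/-- **`#Sel^{(n)}((C • W)/K) = #Sel^{(n)}(W/K)`** (`n ≠ 0`): by the descent count
`#Sel^{(n)} = n^{rk} · #E(K)[n] · #(Ш ⊓ H¹(K,E)[n])` (Silverman X.4.2; tree `natCard_selmerGroup_eq`)
and the invariance of the three factors (`mordellWeilRank_variableChange_holds`,
`natCard_torsionBy_point_smul`, `natCard_sha_inf_torsionBy_smul`). The `n`-Selmer group is attached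
to `E/K`, not to a Weierstrass equation. [cite: SilvermanAEC2009, Thm. X.4.2 with III.3.1(b) and X.§4] -/
theorem natCard_selmerGroup_smul {n : ℕ} (hn : n ≠ 0) :
    Nat.card ((C • W).selmerGroup n) = Nat.card (W.selmerGroup n) := by
  rw [(C • W).natCard_selmerGroup_eq hn, W.natCard_selmerGroup_eq hn,
    natCard_torsionBy_point_smul W C, natCard_sha_inf_torsionBy_smul W C]
  have hr : (C • W).mordellWeilRank = W.mordellWeilRank := mordellWeilRank_variableChange_holds W C
  rw [hr]

end VariableChange

/-! ## §2 Representative-independence of `rk E^{(s)}(K)` and `#Sel^{(n)}(E^{(s)}/K)` on a square class -/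

section Representatives

variable {K : Type u} [Field K] [NumberField K] (V : WeierstrassCurve K)

omit [NumberField K] in
/-- **`rk E^{(s)}(K)` only depends on the square class of `s`**: `E^{(s u²)} ≅_K E^{(s)}`
(`exists_variableChange_quadraticTwist_mul_sq`) and `rk` is an isomorphism invariant
(`mordellWeilRank_variableChange_holds`). [cite: BhargavaKlagsbrunLemkeOliverShnidman2019, §2 (the twists E_s of a squareclass s)]
[cite: SilvermanAEC2009, III.3.1(b)] -/
theorem mordellWeilRank_quadraticTwist_eq_of_mk_eq {s s' : Kˣ}
    (h : (QuotientGroup.mk s : SquareClass K) = QuotientGroup.mk s') :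
    (V.quadraticTwist (s : K)).mordellWeilRank = (V.quadraticTwist (s' : K)).mordellWeilRank := by
  obtain ⟨u, rfl⟩ := exists_eq_mul_sq_of_mk_eq h
  obtain ⟨C, hC⟩ := V.exists_variableChange_quadraticTwist_mul_sq (s : K) (u : K) u.ne_zero
  rw [Units.val_mul, Units.val_pow_eq_pow_val, ← hC]
  exact (mordellWeilRank_variableChange_holds _ C).symm

/-- **`#Sel^{(n)}(E^{(s)}/K)` only depends on the square class of `s`** (`V` elliptic, `n ≠ 0`):
`E^{(s u²)} ≅_K E^{(s)}` and `natCard_selmerGroup_smul`. [cite: BhargavaKlagsbrunLemkeOliverShnidman2019, §2 (the twists E_s of a squareclass s)]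
[cite: SilvermanAEC2009, Thm. X.4.2] -/
theorem natCard_selmerGroup_quadraticTwist_eq_of_mk_eq [V.IsElliptic] {n : ℕ} (hn : n ≠ 0)
    {s s' : Kˣ} (h : (QuotientGroup.mk s : SquareClass K) = QuotientGroup.mk s') :
    Nat.card ((V.quadraticTwist (s : K)).selmerGroup n) =
      Nat.card ((V.quadraticTwist (s' : K)).selmerGroup n) := by
  obtain ⟨u, rfl⟩ := exists_eq_mul_sq_of_mk_eq h
  obtain ⟨C, hC⟩ := V.exists_variableChange_quadraticTwist_mul_sq (s : K) (u : K) u.ne_zero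
  haveI : (V.quadraticTwist (s : K)).IsElliptic := V.isElliptic_quadraticTwist s.ne_zero
  rw [Units.val_mul, Units.val_pow_eq_pow_val, ← hC]
  exact (natCard_selmerGroup_smul _ C hn).symm

omit [NumberField K] in
/-- "`rk E^{([s])}(K) = r`" (every representative) is `rk E^{(s)}(K) = r`, `s ≠ 0`.
[cite: BhargavaKlagsbrunLemkeOliverShnidman2019, Thm. 2.5 (a) ("twists E_s having rank 0")] -/
theorem twistClassSatisfies_mordellWeilRank_squareClassOf_iff (r : ℕ) {s : K} (hs : s ≠ 0) :
    TwistClassSatisfies V (fun E : WeierstrassCurve K ↦ E.mordellWeilRank = r) (squareClassOf s) ↔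
      (V.quadraticTwist s).mordellWeilRank = r :=
  twistClassSatisfies_squareClassOf_iff V (fun E : WeierstrassCurve K ↦ E.mordellWeilRank = r)
    (fun _ _ h ↦ by rw [mordellWeilRank_quadraticTwist_eq_of_mk_eq V h]) hs

/-- "`#Sel^{(n)}(E^{([s])}/K) = m`" (every representative) is `#Sel^{(n)}(E^{(s)}/K) = m`, `s ≠ 0`
(`V` elliptic, `n ≠ 0`). [cite: BhargavaKlagsbrunLemkeOliverShnidman2019, Thm. 2.5 (b) ("3-Selmer rank 1")] -/
theorem twistClassSatisfies_natCard_selmerGroup_squareClassOf_iff [V.IsElliptic] {n : ℕ}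
    (hn : n ≠ 0) (m : ℕ) {s : K} (hs : s ≠ 0) :
    TwistClassSatisfies V (fun E : WeierstrassCurve K ↦ Nat.card (E.selmerGroup n) = m)
        (squareClassOf s) ↔
      Nat.card ((V.quadraticTwist s).selmerGroup n) = m :=
  twistClassSatisfies_squareClassOf_iff V
    (fun E : WeierstrassCurve K ↦ Nat.card (E.selmerGroup n) = m)
    (fun _ _ h ↦ by rw [natCard_selmerGroup_quadraticTwist_eq_of_mk_eq V hn h]) hs

end Representatives

/-! ## §3 The `19a3` clauses in the usual ordering of quadratic twists over `ℚ` -/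

section Cremona19a3

namespace BhargavaKlagsbrunLemkeOliverShnidman2019

/-- **BKLOS 2019 §2, `19a3` (a), usual ordering**: granted the REFEREED fact, at least `25%` of the
squarefree `d` (ordered by `|d|`) have `rk E_d(ℚ) = 0`, `E = 19a3`:
`1/4 ≤ liminf_X #{d squarefree : |d| < X, rk E_d(ℚ) = 0} / #{d squarefree : |d| < X}` (the BKLOS
height ordering over `ℚ` IS this ordering, §2 p0004 L30; dictionary `squareClassProportionGe_twist_rat_iff`
with the invariance `mordellWeilRank_quadraticTwist_eq_of_mk_eq`).
[cite: BhargavaKlagsbrunLemkeOliverShnidman2019, §2 paragraph after Thm. 2.6 (chunk p0005 L41) with §2 (Σ(X) for F = ℚ, p0004 L30)] -/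
theorem cremona19a3_proportion_rank_zero_rat (h : cremona19a3_rankZero_selmerRankOne_proportions) :
    (1 / 4 : ℝ) ≤ liminf (fun X : ℕ ↦
      (Nat.card {d : ℤ | Squarefree d ∧ d.natAbs < X ∧
          (cremona19a3.quadraticTwist (d : ℚ)).mordellWeilRank = 0} : ℝ) /
        Nat.card {d : ℤ | Squarefree d ∧ d.natAbs < X}) atTop :=
  (squareClassProportionGe_twist_rat_iff cremona19a3
    (fun E : WeierstrassCurve ℚ ↦ E.mordellWeilRank = 0)
    (fun _ _ hss' ↦ by rw [mordellWeilRank_quadraticTwist_eq_of_mk_eq cremona19a3 hss'])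
    (1 / 4)).1 h.1

/-- **BKLOS 2019 §2, `19a3` (b), usual ordering**: granted the REFEREED fact, at least `5/12` of the
squarefree `d` (ordered by `|d|`) have `#Sel^{(3)}(E_d/ℚ) = 3` ("`3`-Selmer rank `1`"), `E = 19a3`.
[cite: BhargavaKlagsbrunLemkeOliverShnidman2019, §2 paragraph after Thm. 2.6 (chunk p0005 L41) with §2 (Σ(X) for F = ℚ, p0004 L30)] -/
theorem cremona19a3_proportion_card_selmerGroup_three_rat
    (h : cremona19a3_rankZero_selmerRankOne_proportions) :
    (5 / 12 : ℝ) ≤ liminf (fun X : ℕ ↦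
      (Nat.card {d : ℤ | Squarefree d ∧ d.natAbs < X ∧
          Nat.card ((cremona19a3.quadraticTwist (d : ℚ)).selmerGroup 3) = 3} : ℝ) /
        Nat.card {d : ℤ | Squarefree d ∧ d.natAbs < X}) atTop := by
  haveI := cremona19a3_isElliptic
  exact (squareClassProportionGe_twist_rat_iff cremona19a3
    (fun E : WeierstrassCurve ℚ ↦ Nat.card (E.selmerGroup 3) = 3)
    (fun _ _ hss' ↦ by
      -- the fact's `3` is an integer literal; the invariance lemma speaks of `((3 : ℕ) : ℤ)`
      have h3 := natCard_selmerGroup_quadraticTwist_eq_of_mk_eq cremona19a3 (n := 3) (by norm_num) hss'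
      simp only [Nat.cast_ofNat] at h3
      rw [h3])
    (5 / 12)).1 h.2

/-- **The derived corank clause, usual ordering**: granted the REFEREED `19a3` fact and the
Cassels–Tate pairing (`hCT`), at least `5/12` of the squarefree `d` (ordered by `|d|`) have
`corank_{ℤ₃} Sel_{3^∞}(E_d/ℚ) = 1`, `E = 19a3` (`cremona19a3_proportion_selmerCorank_three_eq_one`
read through `squareClassProportionGe_twist_selmerCorank_rat_iff`-type dictionary).
[cite: BhargavaKlagsbrunLemkeOliverShnidman2019, §2 paragraph after Thm. 2.6 with Thm. 2.5 (b) and its closing sentence (p0005 L22)] -/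
theorem cremona19a3_proportion_selmerCorank_three_eq_one_rat
    (h : cremona19a3_rankZero_selmerRankOne_proportions)
    (hCT : exists_casselsTate_pairing (K := ℚ)) :
    (5 / 12 : ℝ) ≤ liminf (fun X : ℕ ↦
      (Nat.card {d : ℤ | Squarefree d ∧ d.natAbs < X ∧
          (cremona19a3.quadraticTwist (d : ℚ)).selmerCorank 3 = 1} : ℝ) /
        Nat.card {d : ℤ | Squarefree d ∧ d.natAbs < X}) atTop :=
  (squareClassProportionGe_twist_rat_iff cremona19a3
    (fun E : WeierstrassCurve ℚ ↦ E.selmerCorank 3 = 1)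
    (fun _ _ hss' ↦ by rw [selmerCorank_quadraticTwist_eq_of_mk_eq cremona19a3 3 hss'])
    (5 / 12)).1 (cremona19a3_proportion_selmerCorank_three_eq_one h hCT)

end BhargavaKlagsbrunLemkeOliverShnidman2019

end Cremona19a3

end Literature.NumberTheory.EllipticCurves

end
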